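import Mathlib.NumberTheory.LegendreSymbol.QuadraticChar.Basic
import Mathlib.NumberTheory.LegendreSymbol.Basic
import Mathlib.GroupTheory.Perm.Cycle.Basic
import Mathlib.GroupTheory.SpecificGroups.Cyclic
import Mathlib.FieldTheory.Finite.Basic
import Mathlib.Algebra.Group.Action.End
import Mathlib.Tactic
import HarnessLib

/-!
# Zolotarev's lemma: the quadratic character is the sign of the multiplication permutation

Topic `NumberTheory/Congruences`; theorems only (no named fact, no `sorry`); Mathlib-only imports.

[BrunyateClark2014] A. Brunyate, P. L. Clark, *Extending the Zolotarev–Frobenius approach to quadratic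
reciprocity*, Ramanujan J. 37 (2015) 25–50, **Lemma 2.5 (First Zolotarev Lemma)**: "For any odd prime
power `q` and `a ∈ 𝔽_q^×`, we have `[a/𝔽_q] = (a/𝔽_q)`" — the Zolotarev symbol `[a/r] = ε(m_a)`, the
sign of the permutation `m_a : x ↦ x a` of `r` (§2.2), equals the quadratic residue symbol. Printed
proof: "Since `𝔽_q^×` is cyclic of even order, `a ↦ (a/𝔽_q)` is the unique nontrivial group
homomorphism from `𝔽_q^×` to `{±1}`. On the other hand, if `a` is a generator of `𝔽_q^×`, the cycle
type of `m_a` is `(q − 1, 1)`, so `[a/𝔽_q] = −1`." (G. Zolotarev, Nouv. Ann. Math. 11 (1872), for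
`q = p` prime.)

We follow the printed proof for a finite field `F` of odd characteristic:
* `zolotarevSign F` — the signature homomorphism `Fˣ →* ℤˣ`, `a ↦ sign (x ↦ a • x)`;
* `isCycle_toPerm_of_generator`, `zolotarevSign_generator` — for a generator `g` of `Fˣ` the
  permutation `x ↦ g x` of `F` is a single `(q − 1)`-cycle (support `F ∖ {0}`), hence odd;
* `zolotarev` — **Lemma 2.5**: `sign (x ↦ a x) = quadraticChar F a` for every `a ∈ Fˣ`;
* `zolotarev_zmod` — the case `F = ℤ/p` in terms of Mathlib's `legendreSym`.
-/

namespace Literature.NumberTheory.Congruences.Zolotarev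

open Equiv Equiv.Perm Subgroup

variable (F : Type*) [Field F] [Fintype F] [DecidableEq F]

/-- The **Zolotarev symbol** as a homomorphism: `a ↦ ε(m_a)`, the sign of the permutation
`x ↦ a x` of `F` [BrunyateClark2014, §2.2 ("We define the Zolotarev symbol [a/r] = ε(m_a)")].
[cite: BrunyateClark2014, §2.2 (Zolotarev symbol)] -/
noncomputable def zolotarevSign : Fˣ →* ℤˣ :=
  (Perm.sign).comp (MulAction.toPermHom Fˣ F)

variable {F}

/-- Unfolding: `zolotarevSign F a = sign (MulAction.toPerm a)`, the permutation `x ↦ a • x = a x`.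
[cite: BrunyateClark2014, §2.2] -/
theorem zolotarevSign_apply (a : Fˣ) :
    zolotarevSign F a = Perm.sign (MulAction.toPerm a : Perm F) := rfl

omit [Fintype F] [DecidableEq F] in
/-- The permutation `x ↦ a x` moves exactly the non-zero elements when `a ≠ 1`. [folklore]
[cite: BrunyateClark2014, Lemma 2.5 (proof: "the cycle type of m_a is (q − 1, 1)")] -/
theorem toPerm_apply_ne_iff {a : Fˣ} (ha : a ≠ 1) (x : F) :
    (MulAction.toPerm a : Perm F) x ≠ x ↔ x ≠ 0 := by
  rw [MulAction.toPerm_apply, Units.smul_def, smul_eq_mul]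
  constructor
  · rintro h rfl
    exact h (mul_zero _)
  · intro hx h
    apply ha
    have h1 : ((a : F) - 1) * x = 0 := by rw [sub_mul, one_mul, h, sub_self]
    rcases mul_eq_zero.1 h1 with h2 | h2
    · exact Units.ext (by rw [Units.val_one]; exact (sub_eq_zero.1 h2))
    · exact absurd h2 hx

omit [Fintype F] [DecidableEq F] in
/-- For a generator `g` of `Fˣ` (and `|F| > 2`), `x ↦ g x` is a single cycle on `F ∖ {0}`.
[cite: BrunyateClark2014, Lemma 2.5 (proof: "if a is a generator of 𝔽_q^×, the cycle type of m_a is (q − 1, 1)")] -/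
theorem isCycle_toPerm_of_generator {g : Fˣ} (hg : ∀ x : Fˣ, x ∈ zpowers g) (hg1 : g ≠ 1) :
    (MulAction.toPerm g : Perm F).IsCycle := by
  refine ⟨1, by rw [toPerm_apply_ne_iff hg1]; exact one_ne_zero, fun y hy => ?_⟩
  rw [toPerm_apply_ne_iff hg1] at hy
  -- `y = g^k · 1`
  obtain ⟨k, hk⟩ := mem_zpowers_iff.1 (hg (Units.mk0 y hy))
  refine ⟨k, ?_⟩
  change ((MulAction.toPermHom Fˣ F g) ^ k) 1 = y
  rw [← map_zpow, MulAction.toPermHom_apply, MulAction.toPerm_apply, Units.smul_def, smul_eq_mul,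
    mul_one, hk, Units.val_mk0]

/-- The Zolotarev symbol of a generator is `−1`: a `(q − 1)`-cycle with `q − 1` even is odd.
[cite: BrunyateClark2014, Lemma 2.5 (proof)] -/
theorem zolotarevSign_generator (hF : ringChar F ≠ 2) {g : Fˣ} (hg : ∀ x : Fˣ, x ∈ zpowers g) :
    zolotarevSign F g = -1 := by
  classical
  -- `|F|` is odd and `≥ 3`, so `g ≠ 1`
  have hodd : Fintype.card F % 2 = 1 := FiniteField.odd_card_of_char_ne_two hF
  have hcardU : Fintype.card Fˣ = Fintype.card F - 1 := Fintype.card_units F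
  have hord : orderOf g = Fintype.card Fˣ := by
    rw [orderOf_eq_card_of_forall_mem_zpowers hg, Nat.card_eq_fintype_card]
  have h3 : 3 ≤ Fintype.card F := by
    have h2 : 1 < Fintype.card F := Fintype.one_lt_card
    omega
  have hg1 : g ≠ 1 := by
    intro h
    rw [h, orderOf_one] at hord
    omega
  rw [zolotarevSign_apply, (isCycle_toPerm_of_generator hg hg1).sign]
  -- the support is `F ∖ {0}`, of even cardinality `|F| − 1`
  have hsupp : (MulAction.toPerm g : Perm F).support = Finset.univ.erase 0 := by
    ext x
    rw [Perm.mem_support, toPerm_apply_ne_iff hg1, Finset.mem_erase]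
    simp
  rw [hsupp, Finset.card_erase_of_mem (Finset.mem_univ _), Finset.card_univ]
  have heven : Even (Fintype.card F - 1) := ⟨(Fintype.card F - 1) / 2, by omega⟩
  rw [heven.neg_one_pow]

/-- A generator of the cyclic group `Fˣ` of even order is not a square in `F`, so its quadratic
character is `−1`. [cite: BrunyateClark2014, Lemma 2.5 (proof: "𝔽_q^× is cyclic of even order")] -/
theorem quadraticChar_generator (hF : ringChar F ≠ 2) {g : Fˣ} (hg : ∀ x : Fˣ, x ∈ zpowers g) :
    quadraticChar F g = -1 := by
  classical
  rw [quadraticChar_neg_one_iff_not_isSquare]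
  rintro ⟨x, hx⟩
  have hodd : Fintype.card F % 2 = 1 := FiniteField.odd_card_of_char_ne_two hF
  have hcardU : Fintype.card Fˣ = Fintype.card F - 1 := Fintype.card_units F
  have hord : orderOf g = Fintype.card Fˣ := by
    rw [orderOf_eq_card_of_forall_mem_zpowers hg, Nat.card_eq_fintype_card]
  have hx0 : x ≠ 0 := by
    rintro rfl
    rw [mul_zero] at hx
    exact g.ne_zero hx
  -- `x = g^k`, so `g = g^(2k)` and `orderOf g ∣ 2k − 1`, which is odd — impossible.
  obtain ⟨k, hk⟩ := mem_zpowers_iff.1 (hg (Units.mk0 x hx0))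
  have hg2 : g ^ (2 * k - 1) = 1 := by
    have h1 : (g : F) = ((g ^ k * g ^ k : Fˣ) : F) := by
      rw [Units.val_mul, hk, Units.val_mk0]; exact hx
    have h2 : g = g ^ k * g ^ k := Units.ext h1
    rw [show (2 : ℤ) * k - 1 = k + k - 1 by ring, zpow_sub_one, zpow_add, ← h2,
      mul_inv_cancel]
  have hdvd : (orderOf g : ℤ) ∣ 2 * k - 1 := orderOf_dvd_iff_zpow_eq_one.2 hg2
  have heven : (2 : ℤ) ∣ (orderOf g : ℤ) := by
    rw [hord, hcardU]
    exact ⟨((Fintype.card F - 1) / 2 : ℕ), by omega⟩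
  have := dvd_trans heven hdvd
  omega

/-- **Zolotarev's lemma, homomorphism form**: the Zolotarev symbol IS the quadratic character on `Fˣ`.
Proof as printed: both are homomorphisms `Fˣ → {±1}` taking the value `−1` at a generator of the
cyclic group `Fˣ`. [cite: BrunyateClark2014, Lemma 2.5 (First Zolotarev Lemma)] -/
theorem zolotarevSign_eq_toUnitHom (hF : ringChar F ≠ 2) :
    zolotarevSign F = (quadraticChar F).toUnitHom := by
  classical
  obtain ⟨g, hg⟩ := IsCyclic.exists_generator (α := Fˣ)
  refine MonoidHom.ext fun a => ?_
  obtain ⟨k, rfl⟩ := mem_zpowers_iff.1 (hg a)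
  rw [map_zpow, map_zpow, zolotarevSign_generator hF hg]
  congr 1
  ext
  rw [MulChar.coe_toUnitHom, quadraticChar_generator hF hg, Units.val_neg, Units.val_one]

/-- **Zolotarev's lemma** [BrunyateClark2014, Lemma 2.5 (First Zolotarev Lemma)] for a finite field
`F` of odd characteristic: for every `a ∈ Fˣ`, the sign of the permutation `x ↦ a x` of `F` equals the
quadratic character `(a/F)`. [cite: BrunyateClark2014, Lemma 2.5 (First Zolotarev Lemma)] -/
theorem zolotarev (hF : ringChar F ≠ 2) (a : Fˣ) :
    ((zolotarevSign F a : ℤˣ) : ℤ) = quadraticChar F a := by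
  rw [zolotarevSign_eq_toUnitHom hF, MulChar.coe_toUnitHom]

/-- The sign itself, as an element of `ℤˣ`: `sign (x ↦ a x) = (a/F)` read in `ℤˣ` via
`quadraticChar F a = ±1`. [cite: BrunyateClark2014, Lemma 2.5] -/
theorem sign_toPerm_eq_quadraticChar (hF : ringChar F ≠ 2) (a : Fˣ) :
    ((Perm.sign (MulAction.toPerm a : Perm F) : ℤˣ) : ℤ) = quadraticChar F a :=
  zolotarev hF a

/-- **Zolotarev 1872, the prime field**: for an odd prime `p` and `a` prime to `p`, the Legendre
symbol `(a/p)` is the sign of `x ↦ a x` on `ℤ/p`. [cite: BrunyateClark2014, §1 and Lemma 2.5 ("In 1872, G. Zolotarev observed that the Legendre symbol (a/p) is the sign of the permutation of ℤ/pℤ induced by multiplication by a")] -/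
theorem zolotarev_zmod {p : ℕ} [hp : Fact p.Prime] (hp2 : p ≠ 2) (a : (ZMod p)ˣ) :
    ((Perm.sign (MulAction.toPerm a : Perm (ZMod p)) : ℤˣ) : ℤ) = legendreSym p (a : ZMod p).val := by
  have hF : ringChar (ZMod p) ≠ 2 := by rw [ZMod.ringChar_zmod_n]; exact hp2
  rw [sign_toPerm_eq_quadraticChar hF, legendreSym, Int.cast_natCast, ZMod.natCast_zmod_val]

end Literature.NumberTheory.Congruences.Zolotarev
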